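import Literature.NumberTheory.Sieve.LinearEquationsInPrimesThreeForms
import Literature.NumberTheory.Sieve.LinearEquationsInPrimesMetricClass
import Literature.NumberTheory.Sieve.LinearEquationsInPrimesHeisenbergNilmanifold
import HarnessLib

/-!
# Linear equations in primes: the level-2 inputs on the Heisenberg class (Green–Tao 2010, §§8, 12; Green–Tao 2008a,b)

Trunk T-SIEVE (`Literature/NumberTheory/Sieve`).  The tree proves the transference machine of
B. Green, T. Tao, *Linear equations in primes*, Ann. of Math. 171 (2010) at every level `s`
CLASS-LOCALLY (`GreenTao2010_gowersUniformityAt_of_class_of_sharp`): for any class `𝒞` of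
rational, divisible `s`-step nilmanifolds, `GI(s)` with inverse families in `𝒞` + `MN(s)` on
`X^m × ℝ/ℤ` (`X ∈ 𝒞`) + the sharp estimate (12.6)ₛ give `GreenTao2010_gowersUniformityAt s`, and
level `1` is proved (`GreenTao2010_gowersUniformityAt_one`, `GreenTao2010_mainTheorem_of_le_three`).
This file STATES the three printed inputs of LEVEL `2` as closed propositions and proves the
assembly to the Main Theorem for all finite-complexity systems of `t ≤ 4` forms (in particular
the Hardy–Littlewood asymptotic for 4-term progressions of primes):

* `InHeisClass H` — the class of 2-step nilmanifolds generated by a realisation `H` of the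
  Heisenberg nilmanifold and the circle under binary products (Green–Tao 2008a, §12: the inverse
  family for `U³` consists of products of circle and Heisenberg nilflows);
* `GITwoHeis H`, `MNTwoHeis H` — `GI(2)` with inverse families in the class / `MN(2)` on the
  class, for a given realisation `H`; `SharpTwo` — (12.6) at `s = 2` for an admissible cutoff;
* the METRIC.  `Nilmanifold.heisenberg` is metrised by `TopologicalSpace.metrizableSpaceMetric`,
  a choice metric over which `MN(2)` (uniform over all `M`-Lipschitz `F`) is not provable
  (cf. `MetricPathology.not_forall_MNAt`).  The closed statements `GITwo`, `MNTwo` therefore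
  quantify over EVERY distance `d` on `H³(ℝ)/H³(ℤ)` satisfying the axioms of Def. 8.1
  (`IsCompatMetric d`) that is bi-Lipschitz comparable (`IsBoxComparable d`) to the explicit
  right-invariant box pre-distance `heisPreDist (gΓ) (hΓ) = inf_{γ ∈ Γ} S(g γ h⁻¹)`,
  `S(u) = max(‖u‖_∞, ‖u⁻¹‖_∞)` (`boxGauge`); `heisenbergWith d h` is the re-metrised nilmanifold.
  The existence of such a `d` is the separate construction statement `HeisMetricExists`;
* PROVED: `heis_pow` (coordinates of powers), `heisenberg_isDivisible`, `heisGood_with`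
  (rationality and divisibility do not see the metric), the level-2 assembly
  `GreenTaoLevelTwo.gowersUniformityAt_two_of`, `GreenTaoLevelTwo.mainTheoremLeFour_of` and the
  closed form `GreenTao2010_mainTheorem_of_le_four_of_inputs :
  HeisMetricExists → GITwo → MNTwo → SharpTwo → MainTheoremLeFour`.

Nothing here is a new fact: `GITwo` is GT2010 Prop. 8.4 (= Conj. 8.3 at `s = 2`, proved from
Green–Tao 2008a Thm. 12.8), `MNTwo` is GT2010 Conj. 8.5 at `s = 2` = Green–Tao 2008b Thm. 1.1
(restricted to explicit nilmanifolds), `SharpTwo` is GT2010 (12.6) at `s = 2` (App. D with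
`a_i = 1`; the tree proves Thm. D.3 in `…SharpGYCorrelation`);
none of the three is proved here — they are `def`s (statements), consumed as hypotheses.

## References

* B. Green, T. Tao, *Linear equations in primes*, Ann. of Math. (2) 171 (2010), 1753–1850:
  Def. 8.1, Conj. 8.3 (`GI(s)`), Prop. 8.4 (`GI(2)` holds, with products of Heisenberg groups),
  Conj. 8.5 (`MN(s)`) and the Remark after it (`MN(2)` is Green–Tao 2008b), Thm. 7.2, §12, (12.6),
  App. D, App. E. [cite: GreenTao2010]
* B. Green, T. Tao, *An inverse theorem for the Gowers U³(G) norm*, Proc. Edinb. Math. Soc. 51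
  (2008), 73–153 (arXiv:math/0503014): Thm. 12.8, §12 (pp. 37–41 of the arXiv version).
  [cite: GreenTao2008U3Inverse]
* B. Green, T. Tao, *Quadratic uniformity of the Möbius function*, Ann. Inst. Fourier 58 (2008),
  1863–1935 (arXiv:math/0606087): Thm. 1.1. [cite: GreenTao2008QuadraticMobius]
-/

noncomputable section

namespace Literature.NumberTheory.Sieve

namespace GreenTaoLevelTwo

/-! ### The Heisenberg class and the three inputs for a given realisation `H` -/

/-- The Heisenberg class `𝒞₂(H)`: generated by a realisation `H` of `H³(ℝ)/H³(ℤ)` and the circle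
(lifted to step 2), closed under binary products ("take `n₁` nilsequences coming from circle
nilflows, … `n₃` coming from Heisenberg nilflows, and tensor them all together").
[cite: GreenTao2008U3Inverse, §12] -/
inductive InHeisClass (H : Nilmanifold 2) : Nilmanifold 2 → Prop
  | heis : InHeisClass H H
  | circle : InHeisClass H (Nilmanifold.circle.ofLE (by norm_num : 1 ≤ 2))
  | prod {X Y : Nilmanifold 2} : InHeisClass H X → InHeisClass H Y → InHeisClass H (X.prod Y)

/-- `GI(2)` on `[N]` with inverse families drawn from the Heisenberg class of `H` (the `U³[N]`
inverse theorem in the nilsequence form of GT2010 Conj. 8.3, a theorem at `s = 2`).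
[cite: GreenTao2010, Prop. 8.4 (and Conj. 8.3 at s = 2)] [cite: GreenTao2008U3Inverse, Thm. 12.8] -/
def GITwoHeis (H : Nilmanifold 2) : Prop :=
  ∀ δ : ℝ, 0 < δ → δ ≤ 1 → ∃ (m : ℕ) (𝓜 : Fin m → Nilmanifold 2) (MG cG : ℝ),
    (∀ i, InHeisClass H (𝓜 i)) ∧ GreenTao2010_inverseDatum 2 δ 𝓜 MG cG

/-- `MN(2)` for the members of the Heisenberg class of `H`, in the form §12 consumes (on
`X^m × ℝ/ℤ`, every Lipschitz constant, every log-power saving).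
[cite: GreenTao2010, Conj. 8.5 at s = 2 and the Remark after it] [cite: GreenTao2008QuadraticMobius, Thm. 1.1] -/
def MNTwoHeis (H : Nilmanifold 2) : Prop :=
  ∀ X : Nilmanifold 2, InHeisClass H X → ∀ (m : ℕ) (M : ℝ),
    GreenTao2010_MNAt 2 ((X.pow m).prod (Nilmanifold.circle.ofLE (by norm_num : 1 ≤ 2))) M

/-- The sharp estimate (12.6) at level `2` for some admissible cutoff `χ` (`χ = id` on `[0, ½]`,
Lipschitz) and level `R = N^γ`. [cite: GreenTao2010, (12.6) and App. D] -/
def SharpTwo : Prop :=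
  ∃ (χ : ℝ → ℝ) (Lχ γ : ℝ), (∀ x, 0 ≤ x → x ≤ 1 / 2 → χ x = x) ∧
    (∀ x y, |χ x - χ y| ≤ Lχ * |x - y|) ∧ 0 ≤ Lχ ∧ 0 < γ ∧
      GreenTao2010_sharpUniformAt 2 χ fun N => (N : ℝ) ^ γ

/-- A realisation is *good* if it is rational (Lemma E.9) and divisible.
[cite: GreenTao2010, App. E, Lemma E.9] -/
def HeisGood (H : Nilmanifold 2) : Prop := H.IsRational ∧ H.IsDivisible

/-- GT2010 Main Theorem for all finite-complexity systems with `t ≤ 4` forms (the signature of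
`GreenTao2010_mainTheorem_of_le_three` with `t ≤ 4`). [cite: GreenTao2010, Main Theorem (Thm. 1.8)] -/
def MainTheoremLeFour : Prop :=
  ∀ (d t L : ℕ), 1 ≤ d → 1 ≤ t → t ≤ 4 → ∀ ε : ℝ, 0 < ε → ∃ N₀ : ℕ, ∀ N : ℕ, N₀ ≤ N →
    ∀ Ψ : Fin t → AffLinForm d, IsNondegenerateSystem Ψ → IsFiniteComplexitySystem Ψ →
      affLinSize Ψ N ≤ L →
      ∀ K : Set (Fin d → ℝ), Convex ℝ K → K ⊆ realBox d N →
        |vonMangoldtSum Ψ K N - archFactor Ψ K * singularProduct Ψ| ≤ ε * (N : ℝ) ^ d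

/-! ### Divisibility of the Heisenberg group and goodness of the class -/

/-- Coordinates of powers in `H³(ℝ)`: `(gⁿ) = (n x, n y, n z + n(n−1)/2 · x y)` (the Heisenberg
example of §8/§11). [cite: GreenTao2010, §11, Example after Prop. 11.5] -/
theorem heis_pow (g : Heis) (n : ℕ) :
    (g ^ n).x = n * g.x ∧ (g ^ n).y = n * g.y ∧
      (g ^ n).z = n * g.z + ((n : ℝ) * (n - 1) / 2) * (g.x * g.y) := by
  induction n with
  | zero => simp
  | succ n ih =>
    obtain ⟨hx, hy, hz⟩ := ih
    refine ⟨?_, ?_, ?_⟩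
    · rw [pow_succ, Heis.x_mul, hx]; push_cast; ring
    · rw [pow_succ, Heis.y_mul, hy]; push_cast; ring
    · rw [pow_succ, Heis.z_mul, hz, hx]; push_cast; ring

/-- `H³(ℝ)` is divisible: every element has a `q`-th root, `q ≥ 1` (the divisibility hypothesis
`Nilmanifold.IsDivisible` of §12, "immediate for … the Heisenberg group"). [cite: GreenTao2010, §12 (before (12.9))] -/
theorem heisenberg_isDivisible : Nilmanifold.heisenberg.IsDivisible := by
  change ∀ (g : Heis) (q : ℕ), 1 ≤ q → ∃ h : Heis, h ^ q = g
  intro g q hq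
  have hq0 : (q : ℝ) ≠ 0 := by exact_mod_cast (by omega : q ≠ 0)
  refine ⟨Heis.mk (g.x / q) (g.y / q)
    ((g.z - ((q : ℝ) * (q - 1) / 2) * (g.x / q * (g.y / q))) / q), ?_⟩
  obtain ⟨hx, hy, hz⟩ := heis_pow (Heis.mk (g.x / q) (g.y / q)
    ((g.z - ((q : ℝ) * (q - 1) / 2) * (g.x / q * (g.y / q))) / q)) q
  apply Heis.ext
  · rw [hx, Heis.x_mk]; field_simp
  · rw [hy, Heis.y_mk]; field_simp
  · rw [hz, Heis.z_mk, Heis.x_mk, Heis.y_mk]; field_simp; ring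

/-- The tree's (choice-metrised) Heisenberg nilmanifold is good. [cite: GreenTao2010, App. E, Remark after Lemma E.9] -/
theorem heisGood_heisenberg : HeisGood Nilmanifold.heisenberg :=
  ⟨Nilmanifold.heisenberg_isRational, heisenberg_isDivisible⟩

/-- Every member of the Heisenberg class of a good realisation is rational. [cite: GreenTao2010, App. E, Lemma E.9] -/
theorem inHeisClass_isRational {H : Nilmanifold 2} (hH : HeisGood H) :
    ∀ X : Nilmanifold 2, InHeisClass H X → X.IsRational := by
  intro X hX
  induction hX with
  | heis => exact hH.1
  | circle =>
    exact (Nilmanifold.isRational_ofLE_iff _ _).mpr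
      (Nilmanifold.isRational_of_le_one (X := Nilmanifold.circle) le_rfl)
  | prod _ _ ihX ihY => exact Nilmanifold.isRational_prod (hX := ihX) (hY := ihY)

/-- Every member of the Heisenberg class of a good realisation is divisible. [cite: GreenTao2010, §12 (before (12.9))] -/
theorem inHeisClass_isDivisible {H : Nilmanifold 2} (hH : HeisGood H) :
    ∀ X : Nilmanifold 2, InHeisClass H X → X.IsDivisible := by
  intro X hX
  induction hX with
  | heis => exact hH.2
  | circle => exact Nilmanifold.isDivisible_ofLE _ _ Nilmanifold.isDivisible_circle
  | prod _ _ ihX ihY => exact Nilmanifold.isDivisible_prod (hX := ihX) (hY := ihY)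

/-! ### The level-2 assembly for a given realisation -/

/-- **Level 2 of Thm. 7.2 from the three printed inputs on the Heisenberg class** (the tree's
class-local reduction `GreenTao2010_gowersUniformityAt_of_class_of_sharp` at `s = 2`).
[cite: GreenTao2010, Thm. 7.2 (proof, §12)] -/
theorem gowersUniformityAt_two_of {H : Nilmanifold 2} (hH : HeisGood H) (hGI : GITwoHeis H)
    (hMN : MNTwoHeis H) (hS : SharpTwo) : GreenTao2010_gowersUniformityAt 2 := by
  obtain ⟨χ, Lχ, γ, hχ0, hχL, hLχ, hγ, hSharp⟩ := hS
  exact GreenTao2010_gowersUniformityAt_of_class_of_sharp (by norm_num : 1 ≤ 2)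
    {X | InHeisClass H X} (fun X hX => inHeisClass_isRational hH X hX)
    (fun X hX => inHeisClass_isDivisible hH X hX)
    (fun δ hδ hδ1 => by
      obtain ⟨m, 𝓜, MG, cG, hmem, hd⟩ := hGI δ hδ hδ1
      exact ⟨m, 𝓜, MG, cG, hmem, hd⟩)
    (fun X hX m M => hMN X hX m M) hχ0 hχL hLχ hγ hSharp

/-- **GT2010 Main Theorem for `t ≤ 4` forms from level-2 Gowers uniformity** (the tree's
level-by-level architecture at `s = 2`). [cite: GreenTao2010, Main Theorem (proof, §§4–7)] -/
theorem mainTheoremLeFour_of_gowersUniformityAt_two (h : GreenTao2010_gowersUniformityAt 2) :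
    MainTheoremLeFour :=
  GreenTao2010_main_of_mainNormalFormAt (s := 2)
    (GreenTao2010_mainNormalForm_of_wTricked_holds 2 (by norm_num)
      (GreenTao2010_wTricked_of_wTrickedProduct 2
        (GreenTao2010_wTrickedProduct_of_gowersUniformity_holds 2 (by norm_num) h)))

/-- The rung for any good realisation `H`:
`GI(2)|𝒞₂(H) → MN(2)|𝒞₂(H) → (12.6)₂ → Main Theorem (t ≤ 4)`. [cite: GreenTao2010, Thm. 7.2 and Main Theorem] -/
theorem mainTheoremLeFour_of {H : Nilmanifold 2} (hH : HeisGood H) (hGI : GITwoHeis H)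
    (hMN : MNTwoHeis H) (hS : SharpTwo) : MainTheoremLeFour :=
  mainTheoremLeFour_of_gowersUniformityAt_two (gowersUniformityAt_two_of hH hGI hMN hS)

/-! ### Closed statements: every metric comparable to the explicit box pre-distance -/

/-- The carrier of the Heisenberg nilmanifold `H³(ℝ)/H³(ℤ)` (quotient by the lattice acting on
the right). [cite: GreenTao2010, Def. 8.1] -/
abbrev HX : Type := Heis ⧸ Heis.latticeΓ

/-- The symmetrised box gauge `S(u) = max(|x|, |y|, |z|, |x'|, |y'|, |z'|)` where
`u = (x, y, z)`, `u⁻¹ = (x', y', z')`. [cite: GreenTao2008U3Inverse, §12 (the cube metric)] -/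
def boxGauge (u : Heis) : ℝ :=
  max (max |u.x| (max |u.y| |u.z|)) (max |u⁻¹.x| (max |u⁻¹.y| |u⁻¹.z|))

/-- The explicit right-invariant box pre-distance `ρ₀(gΓ, hΓ) = inf_{γ ∈ Γ} S(g γ h⁻¹)` (the set
`{g γ h⁻¹ : γ ∈ Γ}` does not depend on the representatives). [cite: GreenTao2008U3Inverse, §12 (the cube metric)] -/
def heisPreDist (p q : HX) : ℝ :=
  ⨅ γ : Heis.latticeΓ, boxGauge (Quotient.out p * (γ : Heis) * (Quotient.out q)⁻¹)

/-- The five metric axioms of Def. 8.1 for a candidate distance on `H³(ℝ)/H³(ℤ)` (a metric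
inducing the quotient topology). [cite: GreenTao2010, Def. 8.1] -/
structure IsCompatMetric (d : HX → HX → ℝ) : Prop where
  dist_self : ∀ x, d x x = 0
  dist_comm : ∀ x y, d x y = d y x
  dist_triangle : ∀ x y z, d x z ≤ d x y + d y z
  eq_of_dist_eq_zero : ∀ x y, d x y = 0 → x = y
  isOpen_iff : ∀ U : Set HX, IsOpen U ↔ ∀ x ∈ U, ∃ ε : ℝ, 0 < ε ∧ ∀ y, d x y < ε → y ∈ U

/-- Bi-Lipschitz comparability of `d` with the explicit box pre-distance (all "sensible" metrics
on a nilmanifold are comparable; Green–Tao fix one via a Mal'cev basis). [cite: GreenTao2012Nilmanifolds, Def. 2.2] -/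
def IsBoxComparable (d : HX → HX → ℝ) : Prop :=
  ∃ L : ℝ, 0 < L ∧ ∀ p q, heisPreDist p q ≤ L * d p q ∧ d p q ≤ L * heisPreDist p q

/-- The Heisenberg nilmanifold re-metrised by a compatible distance `d`. [cite: GreenTao2010, Def. 8.1] -/
def heisenbergWith (d : HX → HX → ℝ) (h : IsCompatMetric d) : Nilmanifold 2 :=
  { Nilmanifold.heisenberg with
    dist := d
    dist_self := h.dist_self
    dist_comm := h.dist_comm
    dist_triangle := h.dist_triangle
    eq_of_dist_eq_zero := h.eq_of_dist_eq_zero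
    isOpen_iff := h.isOpen_iff }

/-- **`GI(2)`, closed form**: for every compatible, box-comparable metric, the `U³[N]` inverse
theorem with inverse families in the Heisenberg class (a THEOREM in print, stated here).
[cite: GreenTao2010, Prop. 8.4] [cite: GreenTao2008U3Inverse, Thm. 12.8] -/
def GITwo : Prop :=
  ∀ (d : HX → HX → ℝ) (h : IsCompatMetric d), IsBoxComparable d → GITwoHeis (heisenbergWith d h)

/-- **`MN(2)`, closed form**: for every compatible, box-comparable metric, Möbius is orthogonal to
the 2-step nilsequences of the Heisenberg class with arbitrary log-power saving (a THEOREM in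
print, stated here). [cite: GreenTao2010, Conj. 8.5 and the Remark after it (the case s = 2)]
[cite: GreenTao2008QuadraticMobius, Thm. 1.1] -/
def MNTwo : Prop :=
  ∀ (d : HX → HX → ℝ) (h : IsCompatMetric d), IsBoxComparable d → MNTwoHeis (heisenbergWith d h)

/-- **Construction statement**: a compatible, box-comparable metric on `H³(ℝ)/H³(ℤ)` exists
(e.g. the chain metric generated by `ρ₀`, or the Mal'cev-basis metric of Green–Tao).
[cite: GreenTao2012Nilmanifolds, Def. 2.2 and App. A (nondegeneracy of the metric; comparison of metrics on nilmanifolds)] [cite: GreenTao2008U3Inverse, §12 (the cube metric)] -/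
def HeisMetricExists : Prop := ∃ d : HX → HX → ℝ, IsCompatMetric d ∧ IsBoxComparable d

/-- Rationality and divisibility do not see the metric. [cite: GreenTao2010, App. E, Remark after Lemma E.9] -/
theorem heisGood_with (d : HX → HX → ℝ) (h : IsCompatMetric d) : HeisGood (heisenbergWith d h) :=
  ⟨Nilmanifold.heisenberg_isRational, heisenberg_isDivisible⟩

end GreenTaoLevelTwo

open GreenTaoLevelTwo in
/-- **The level-2 rung with closed hypotheses**: an explicit compatible metric + `GI(2)` + `MN(2)`
on the Heisenberg class + (12.6)₂ give the Main Theorem of Green–Tao 2010 for every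
finite-complexity system of `t ≤ 4` forms. [cite: GreenTao2010, Thm. 7.2 and Main Theorem]
[cite: GreenTao2008U3Inverse, Thm. 12.8] [cite: GreenTao2008QuadraticMobius, Thm. 1.1] -/
theorem GreenTao2010_mainTheorem_of_le_four_of_inputs (hD : HeisMetricExists) (hGI : GITwo)
    (hMN : MNTwo) (hS : SharpTwo) : MainTheoremLeFour := by
  obtain ⟨d, h, hc⟩ := hD
  exact mainTheoremLeFour_of (heisGood_with d h) (hGI d h hc) (hMN d h hc) hS

end Literature.NumberTheory.Sieve
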